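import Literature.AlgebraicGeometry.Resolution.AlterationsSemiStable
import Literature.AlgebraicGeometry.Resolution.AlterationsSemiStableCodimTwoProofs
import Literature.AlgebraicGeometry.Resolution.GeometricallyRegularFG
import Mathlib.AlgebraicGeometry.Morphisms.Descent
import Mathlib.RingTheory.RingHom.FaithfullyFlat
import HarnessLib

/-!
# `WildQuotients.SummitReduction` (stmt-ResolutionOfSingularities-16324), line `FramePerfect`:
# `codim(Sing X, X) ≥ 2` for the `G`-semi-stable pairs of the line (input (h0) of stub `stub_pair_ssCodimThree`)

Route `ResolutionOfSingularities/WildQuotients`, crux `SummitReduction`; helper file of the line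
skeleton `Cruxes/SummitReduction/Lines/FramePerfect.lean` (v6), stub A (`stub_pair_ssCodimThree`,
de Jong 1996, Lemma 3.2 made `G`-equivariant). The sibling file
`…WildQuotientsSummitReductionStubPairSsCodimThreeLemmas` reduced stub A to two sections-free
statements; this file DISCHARGES the first one, de Jong 1996, 3.4, parenthetical — "(Note that
`codim(Sing(X), X) ≥ 2`, either by the formulae above, or by noting that `X` is normal.)" — in the
binder conventions of the line: `Y` regular integral (NOT assumed of finite type), `D ⊆ Y` a
strict normal crossings divisor, `X` integral projective over a field `k`, `f : X ⟶ Y` a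
semi-stable curve smooth over `Y ∖ D`. The tree proves it for pairs in Situation 4.23
(`DeJong1996SemiStableSingCodimTwo_holds`, `Y` projective); the only new input is that the base
`Y` of such a pair is locally Noetherian, which is proved here by faithfully flat descent along the
flat proper surjection `f` (Stacks 033E at the level of rings, `isNoetherianRing_of_faithfullyFlat`):

* `isNoetherianRing_of_flat_surjective_of_isAffine`, `isNoetherianRing_top_of_flat_surjective`,
  `isLocallyNoetherian_of_flat_surjective` — **local Noetherianity descends along flat
  quasi-compact surjections** (fpqc descent of "locally Noetherian");
* `surjective_of_isSemiStableCurve` — a semi-stable curve with integral source over an integral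
  base is surjective (open and closed with non-empty source);
* `isLocallyNoetherian_base`, `isRegularLocalRing_of_smooth_of_isRegular` (3.1: `Sing X ⊆ Sing f`);
* `two_le_ringKrullDim_of_not_isRegularLocalRing` — (h0) of the sibling file, discharged.
-/

set_option linter.dupNamespace false

noncomputable section

open CategoryTheory CategoryTheory.Limits AlgebraicGeometry TopologicalSpace Order
open Literature.AlgebraicGeometry.Resolution
open Literature.AlgebraicGeometry

namespace Summit.ResolutionOfSingularities.ResolutionOfSingularities.Theorems

/-! ## fpqc descent of local Noetherianity -/

/-- **Noetherianity descends along a flat surjection of affine schemes**: if `g : W ⟶ Y` is flat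
and surjective with `W`, `Y` affine and `Γ(W)` Noetherian, then `Γ(Y)` is Noetherian — `Γ(Y) → Γ(W)`
is flat and surjective on spectra, i.e. faithfully flat (Stacks 00HQ), and Noetherianity descends
along faithfully flat ring maps (Stacks 033E). [cite: StacksProject, Tag 033E] -/
theorem isNoetherianRing_of_flat_surjective_of_isAffine {W Y : Scheme.{0}} [IsAffine W] [IsAffine Y]
    (g : W ⟶ Y) [Flat g] [Surjective g] [IsNoetherianRing Γ(W, ⊤)] : IsNoetherianRing Γ(Y, ⊤) := by
  have hflat : (g.appTop).hom.Flat := (HasRingHomProperty.iff_of_isAffine (P := @Flat)).mp ‹_›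
  haveI : Surjective (Spec.map g.appTop) := by
    have e : Spec.map g.appTop = W.isoSpec.inv ≫ g ≫ Y.isoSpec.hom := by
      rw [← Scheme.isoSpec_hom_naturality, Iso.inv_hom_id_assoc]
    rw [e]
    infer_instance
  have hff : (g.appTop).hom.FaithfullyFlat :=
    RingHom.FaithfullyFlat.iff_flat_and_comap_surjective.mpr
      ⟨hflat, (Spec.map g.appTop).surjective⟩
  letI : Algebra Γ(Y, ⊤) Γ(W, ⊤) := (g.appTop).hom.toAlgebra
  haveI : Module.FaithfullyFlat Γ(Y, ⊤) Γ(W, ⊤) := hff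
  exact isNoetherianRing_of_faithfullyFlat Γ(Y, ⊤) Γ(W, ⊤)

/-- **Noetherianity descends along a flat quasi-compact surjection onto an affine scheme**: if
`f : X ⟶ Y` is flat, surjective and quasi-compact, `X` is locally Noetherian and `Y` is affine,
then `Γ(Y)` is Noetherian — dominate the quasi-compact `X` by a finite disjoint union `W` of affine
opens (an affine scheme, locally isomorphic to `X`, hence locally Noetherian) and apply
`isNoetherianRing_of_flat_surjective_of_isAffine` to `W ⟶ Y`. [cite: StacksProject, Tag 033E] -/
theorem isNoetherianRing_top_of_flat_surjective {X Y : Scheme.{0}} (f : X ⟶ Y) [Flat f]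
    [Surjective f] [QuasiCompact f] [IsLocallyNoetherian X] [IsAffine Y] :
    IsNoetherianRing Γ(Y, ⊤) := by
  haveI : CompactSpace X := QuasiCompact.compactSpace_of_compactSpace f
  obtain ⟨W, p, hp, hploc, hW⟩ :=
    Scheme.exists_hom_isAffine_of_isZariskiLocalAtSource (P := @IsLocalIso) X
  haveI := hp
  haveI := hW
  haveI := hploc
  -- `W` is locally Noetherian: it is covered by opens mapping isomorphically onto opens of `X`
  haveI : IsLocallyNoetherian W := by
    choose U hU hUp using hploc.exists_isOpenImmersion
    have hcov : IsOpenCover U := top_le_iff.mp fun w _ => Opens.mem_iSup.mpr ⟨w, hU w⟩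
    rw [isLocallyNoetherian_iff_openCover (W.openCoverOfIsOpenCover U hcov)]
    intro w
    show IsLocallyNoetherian (U w)
    exact @isLocallyNoetherian_of_isOpenImmersion _ _ ((U w).ι ≫ p) (hUp w) _
  haveI : Flat p := IsLocalIso.le_of_isZariskiLocalAtSource (P := @Flat) _ _ _ hploc
  haveI : IsNoetherianRing Γ(W, ⊤) :=
    IsLocallyNoetherian.component_noetherian ⟨⊤, isAffineOpen_top W⟩
  exact isNoetherianRing_of_flat_surjective_of_isAffine (p ≫ f)

/-- **fpqc descent of local Noetherianity**: if `f : X ⟶ Y` is flat, surjective and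
quasi-compact and `X` is locally Noetherian, then `Y` is locally Noetherian (apply the affine
case over every affine open of `Y`). [cite: StacksProject, Tag 033E] -/
theorem isLocallyNoetherian_of_flat_surjective {X Y : Scheme.{0}} (f : X ⟶ Y) [Flat f]
    [Surjective f] [QuasiCompact f] [IsLocallyNoetherian X] : IsLocallyNoetherian Y := by
  refine isLocallyNoetherian_of_affine_cover (S := fun V : Y.affineOpens => V)
    (iSup_affineOpens_eq_top Y) fun V => ?_
  haveI : IsAffine (V : Y.Opens) := V.2
  haveI : Surjective (f ∣_ (V : Y.Opens)) := IsZariskiLocalAtTarget.restrict (P := @Surjective) ‹_› _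
  haveI := isNoetherianRing_top_of_flat_surjective (f ∣_ (V : Y.Opens))
  exact isNoetherianRing_of_ringEquiv _ (V : Y.Opens).topIso.commRingCatIsoToRingEquiv

/-! ## The base of a semi-stable curve with projective total space -/

/-- A semi-stable curve (flat, proper, of finite presentation, with connected — in particular
non-empty — geometric fibres) from an integral scheme to an integral scheme is surjective: it is
dominant (open with non-empty source) and closed. [cite: DeJong1996, 2.21, p. 61] -/
theorem surjective_of_isSemiStableCurve {X Y : Scheme.{0}} [IsIntegral X] [IsIntegral Y]
    {f : X ⟶ Y} (hss : IsSemiStableCurve f) : Surjective f := by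
  haveI := hss.isDominant
  haveI := hss.isProper
  exact surjective_of_isDominant_of_isClosed_range f f.isClosedMap.isClosed_range

/-- **The base of a semi-stable curve with Noetherian integral total space is locally
Noetherian** (fpqc descent along the flat proper surjection `f`). In the line: `X` is projective
over a field, hence Noetherian, while nothing of finite type is assumed of the regular base `Y`.
[cite: StacksProject, Tag 033E] -/
theorem isLocallyNoetherian_base {X Y : Scheme.{0}} [IsIntegral X] [IsIntegral Y]
    [IsLocallyNoetherian X] {f : X ⟶ Y} (hss : IsSemiStableCurve f) : IsLocallyNoetherian Y := by
  haveI := hss.flat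
  haveI := hss.isProper
  haveI := surjective_of_isSemiStableCurve hss
  exact isLocallyNoetherian_of_flat_surjective f

/-- **de Jong 1996, 3.1: "the singular locus `Sing(X)` of the scheme `X` is contained in
`Sing(f)`"** in the binder conventions of the line: over a regular locally Noetherian `Y`, the
points of an open `U ⊆ X` on which `f` is smooth are regular points of `X` (EGA IV₄ 17.5.8 (iii),
`isRegularLocalRing_stalk_of_smooth`). [cite: DeJong1996, 3.1, p. 62] -/
theorem isRegularLocalRing_of_smooth_of_isRegular {X Y : Scheme.{0}} [IsLocallyNoetherian Y]
    (hreg : Scheme.IsRegular Y) (f : X ⟶ Y) {U : X.Opens} (hU : Smooth (U.ι ≫ f)) {x : X}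
    (hx : x ∈ U) : IsRegularLocalRing (X.presheaf.stalk x) := by
  haveI : IsRegularLocalRing ((U : Scheme.{0}).presheaf.stalk ⟨x, hx⟩) :=
    isRegularLocalRing_stalk_of_smooth (U.ι ≫ f) ⟨x, hx⟩ (hreg _)
  exact IsRegularLocalRing.of_ringEquiv
    (asIso (U.ι.stalkMap ⟨x, hx⟩)).commRingCatIsoToRingEquiv.symm

/-! ## 3.4, parenthetical: `codim(Sing X, X) ≥ 2` -/

/-- **de Jong 1996, 3.4, parenthetical — `codim(Sing(X), X) ≥ 2` — for the `G`-semi-stable pairs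
of the line** (input (h0) of `stub_pair_ssCodimThree_of_singCodimTwo_of_orbitModification`,
discharged): for `Y` regular integral, `D ⊆ Y` a strict normal crossings divisor, `X` integral
projective over `k`, `f : X ⟶ Y` a semi-stable curve smooth over `Y ∖ D`, every non-regular point
`x ∈ X` has `dim 𝒪_{X,x} ≥ 2`. Proof as in the tree's `DeJong1996SemiStableSingCodimTwo_holds`
(Situation 4.23), once `Y` is known to be locally Noetherian (`isLocallyNoetherian_base`): `x` lies
in no open on which `f` is smooth (3.1), so `s = f(x) ∈ D` and `dim 𝒪_{Y,s} ≥ 1`;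
`dim 𝒪_{X,x} = dim 𝒪_{Y,s} + dim 𝒪_{X_s,x}` by flatness (EGA IV₂ 6.1.2); and
`dim 𝒪_{X_s,x} ≥ 1`, since otherwise the reduced zero-dimensional `𝒪_{X_s,x}` is a field and
`𝒪_{X,x}` is regular (Matsumura 23.7 (ii)). [cite: DeJong1996, 3.4, p. 63] -/
theorem two_le_ringKrullDim_of_not_isRegularLocalRing (k : Type) [Field k] {X Y : Scheme.{0}}
    [IsIntegral X] [IsIntegral Y] (f : X ⟶ Y) (q : Y ⟶ Spec (.of k))
    (hprojX : Motives.IsProjectiveOver (Over.mk (f ≫ q))) (hreg : Scheme.IsRegular Y)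
    (D : Set Y) (hD : IsStrictNormalCrossingsDivisor Y D) (hss : IsSemiStableCurve f)
    (hsm : Smooth (f ∣_ ⟨Dᶜ, hD.isClosed.isOpen_compl⟩)) (x : X)
    (hx : ¬ IsRegularLocalRing (X.presheaf.stalk x)) :
    (2 : WithBot ℕ∞) ≤ ringKrullDim (X.presheaf.stalk x) := by
  haveI := DeJong1996.isNoetherian_of_isProjectiveOver (f ≫ q) hprojX
  haveI := isLocallyNoetherian_base hss
  haveI : Flat f := hss.flat
  haveI := hss.locallyOfFiniteType
  -- 3.1: `x ∈ Sing(f)`, in particular `f x ∈ D`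
  have hsD : f x ∈ D := by
    by_contra hxD
    let V : Y.Opens := ⟨Dᶜ, hD.isClosed.isOpen_compl⟩
    have hxV : x ∈ f ⁻¹ᵁ V := hxD
    haveI : Smooth (f ∣_ V) := hsm
    have hsmV : Smooth ((f ⁻¹ᵁ V).ι ≫ f) := by
      rw [← morphismRestrict_ι]
      infer_instance
    exact hx (isRegularLocalRing_of_smooth_of_isRegular hreg f hsmV hxV)
  -- `dim 𝒪_{Y, f x} ≥ 1`
  have hY1 : (1 : WithBot ℕ∞) ≤ ringKrullDim (Y.presheaf.stalk (f x)) := by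
    obtain ⟨r, e, -, -, hr, hdim, -, -⟩ := hD.exists_regularSystemOfParameters hsD
    rw [hdim]
    exact_mod_cast (show 1 ≤ r + e by omega)
  -- the fibre `X_{f x}` is reduced, locally Noetherian; its local ring at `x` has `dim ≥ 1`
  haveI : IsReduced (f.fiber (f x)) := hss.isReduced_fiber (f x)
  haveI : LocallyOfFiniteType (f.fiberToSpecResidueField (f x)) :=
    MorphismProperty.pullback_snd _ _ inferInstance
  haveI : IsLocallyNoetherian (f.fiber (f x)) :=
    LocallyOfFiniteType.isLocallyNoetherian (f.fiberToSpecResidueField (f x))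
  have hR1 : (1 : WithBot ℕ∞) ≤ ringKrullDim ((f.fiber (f x)).presheaf.stalk (f.asFiber x)) := by
    by_contra hlt
    have hle := ringKrullDim_le_zero_of_not_one_le
      ((f.fiber (f x)).presheaf.stalk (f.asFiber x)) hlt
    haveI : Ring.KrullDimLE 0 ((f.fiber (f x)).presheaf.stalk (f.asFiber x)) :=
      Ring.krullDimLE_iff.mpr hle
    have hF : IsField ((f.fiber (f x)).presheaf.stalk (f.asFiber x)) :=
      Ring.KrullDimLE.isField_of_isReduced
    exact hx (isRegularLocalRing_stalk_of_isField_stalk_fiber f x (hreg _) hF)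
  -- EGA IV₂ 6.1.2: `dim 𝒪_{X,x} = dim 𝒪_{Y, f x} + dim 𝒪_{X_{f x}, x}`
  have h3 := Literature.AlgebraicGeometry.Motives.coheight_eq_coheight_add_ringKrullDim_stalk_fiber f x
  rw [ringKrullDim_stalk_eq_coheight] at hY1 ⊢
  calc (2 : WithBot ℕ∞) = 1 + 1 := one_add_one_eq_two.symm
    _ ≤ (coheight (f x) : WithBot ℕ∞) +
          ringKrullDim ((f.fiber (f x)).presheaf.stalk (f.asFiber x)) := add_le_add hY1 hR1
    _ = coheight x := h3.symm

end Summit.ResolutionOfSingularities.ResolutionOfSingularities.Theorems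

end
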